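import Summits.QuantumFields.YangMills.Theorems.WeakCouplingRates
import Summits.QuantumFields.YangMills.Theorems.WeakCouplingRatesDefs
import Summits.QuantumFields.YangMills.Theorems.AllWindowsColdBoxBoxWindowOfDominationRel
import Literature.MathematicalPhysics.QuantumLattice.LatticeGaugeDLR
import HarnessLib

/-!
# LINE-19 «Landau sector: log-concave reduction + relative second order» on crux `AllWindowsColdBox.BoxHighWindowsSU22`
# (⟨stmt-QuantumFields-24004⟩; LOW item ⟨stmt-QuantumFields-24335⟩ `BoxWindowLowSU2213`): the FIXED DATA of the line and its
# obligation Props, VERBATIM from the registered skeleton of record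
# (planner ym-idea-2 g15/g16, skeleton v9, sha16 `f1519a877fd86581`, tree `Cruxes/BoxHighWindowsSU22/Lines/landau_sector_relative_bl.lean`
# commit 6fbfdee53400, critic idea-crit-4 g9 STAMP-BY-HASH 2026-08-29T10:46:37Z «PASS carries, no price»).

The registered stubs S1 `stub_hodgePoincare : HodgePoincareColdBox`, S2 `stub_kernelHodgeForm : DirProjKernelHodgeForm`,
S3 `stub_landauKernelBounds : LandauVarianceBounded ∧ LandauKernelDecay`, S4 `stub_gaugeBallReduction : ∀ θL < 1/12, ∃ κ, …`,
S4b `stub_landauRepresentative : LandauRepresentativeBound`, S5 `stub_landauSecondOrder : ∀ θL < 1/12, … → LandauRelativeComparison θL`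
of LINE-19 are stated over objects that the skeleton DEFINES (they are not in the tree): the pinning predicate `landauPin`, the free-edge
type `LandauFree`, `interiorSites`, `gradVec`, the Hodge precision matrix `hodgeQ`, `landauCoeff`, `SU2`, `IsInteriorGauge`, `linkDefect`,
`InGaugeBall`, `ColdWall`, `SmallPlaquettes`, `InLandauGauge`, and the Props `HodgePoincareColdBox`, `DirProjKernelHodgeForm`,
`LandauVarianceBounded`, `LandauKernelDecay`, `LandauRepresentativeBound`, `GaugeBallReduction`, `LandauRelativeComparison`,
`RelativeCurrency`, `BoxWindowLowSU22`, `BoxWindowHighSU22`.  This file copies them VERBATIM (same names, same bodies; the only change is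
that `landauPin` is an `abbrev` so that `DecidablePred (landauPin H)` is found by unfolding instead of by a declared `instance`) into the
shared namespace `…Theorems.AllWindowsColdBoxBoxHighLine`, so that the provers of S1–S5 work against ONE tree copy and their by-name files
`theorem stub_… : <Prop>` agree literally with the registered signatures (the LINE-17 precedent `…Theorems.AllWindowsColdBoxBoxMidLine`,
✓p706567).  Definitions only; nothing is proved here.  S6 `stub_boxWindowHigh13` is the route item ⟨stmt-QuantumFields-24336⟩ by name
(declared RG residual, NOT staffed) and needs no copy.

Attack order of record (critic g8/g9): S2 → S4b → S4 → S1 (Plan D, face bound state) → S3 → S5; plans: ideator HOME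
`run/shared/lean/pub/ideators/ym-idea-2/l23/STUB-PLAN-LINE19.md` (+ §AMENDMENT, §A2) and `l26/STUB-PLAN-S4b-24004.md`.

HONEST LABEL: bookkeeping for ONE critic-PASSed line on the R2ξ″ all-windows crux ⟨24004⟩ / its low item ⟨24335⟩; no crux, rung or
summit is proved; the Yang–Mills mass gap is NOT proved by this file.
-/

set_option autoImplicit false

noncomputable section

open MeasureTheory Matrix
open Literature.MathematicalPhysics.QuantumFieldTheory
open Literature.MathematicalPhysics.QuantumFieldTheory.LatticeMaxwell
open Literature.MathematicalPhysics.QuantumFieldTheory.AxialGauge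
open Summit.QuantumFields.YangMills.Theorems.WeakCouplingRates

namespace Summit.QuantumFields.YangMills.Theorems.AllWindowsColdBoxBoxHighLine

/-! ## Landau / Hodge objects of the cold box (verbatim from the skeleton, §«Landau / Hodge objects of the cold box») -/

/-- Landau pinning predicate: an edge is pinned iff it is NOT an edge of the cold box (no gauge forest).
(`abbrev` here — `def` + `instance DecidablePred` in the skeleton — so that decidability is inferred by unfolding.) -/
abbrev landauPin (H : ℕ) : Literature.MathematicalPhysics.QuantumLattice.ZdEdge 4 → Prop := fun e => e ∉ boxEdges 4 (2 * H + 1)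

/-- All edges of the cold box as free variables inside the enlarged block. -/
abbrev LandauFree (H : ℕ) : Type := LatticeMaxwell.Free (landauPin H) dirCorner (2 * H + 3)

/-- Interior sites of `{0,…,2H}⁴` (all coordinates in `[1, 2H−1]`): the support of admissible gauge transformations. -/
def interiorSites (H : ℕ) : Finset (Literature.Probability.LatticeModels.Site 4) :=
  Fintype.piFinset fun _ => Finset.Icc (1 : ℤ) (2 * (H : ℤ) - 1)

/-- Gauge-mode (lattice gradient) vector of the site `x` on the free edges. -/
def gradVec (H : ℕ) (x : Literature.Probability.LatticeModels.Site 4) : LandauFree H → ℝ := fun e =>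
  (if e.1.1.1 + Pi.single e.1.1.2 1 = x then (1 : ℝ) else 0) - (if e.1.1.1 = x then (1 : ℝ) else 0)

/-- Hodge precision matrix `Q_L + Σ_{x interior} g_x g_xᵀ` (`= d₁ᵀd₁ + d₀d₀ᵀ`). -/
def hodgeQ (H : ℕ) : Matrix (LandauFree H) (LandauFree H) ℝ :=
  Qmat (landauPin H) dirCorner (2 * H + 3) + ∑ x ∈ interiorSites H, vecMulVec (gradVec H x) (gradVec H x)

/-- Circulation coefficient vector of a plaquette on the Landau free edges. -/
def landauCoeff (H : ℕ) (p : Plaq 4) : LandauFree H → ℝ := coeff (landauPin H) dirCorner (2 * H + 3) p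

/-- S1 statement: Hodge–Poincaré, `λ_min(hodgeQ H) ≥ c/H²`. -/
def HodgePoincareColdBox : Prop :=
  ∃ c : ℝ, 0 < c ∧ ∀ H : ℕ, 1 ≤ H → ∀ v : LandauFree H → ℝ, c / (H : ℝ) ^ 2 * (v ⬝ᵥ v) ≤ v ⬝ᵥ (hodgeQ H *ᵥ v)

/-- S2 statement: the forest-gauge projection kernel is the Hodge kernel (gauge change). -/
def DirProjKernelHodgeForm : Prop :=
  ∀ H : ℕ, 1 ≤ H → ∀ p q : Plaq 4, boxDirProjKernel H p q = landauCoeff H p ⬝ᵥ ((hodgeQ H)⁻¹ *ᵥ landauCoeff H q)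

/-- S3a statement: bounded Landau variances (walls and corners included). -/
def LandauVarianceBounded : Prop :=
  ∃ C : ℝ, ∀ H : ℕ, 1 ≤ H → ∀ e : LandauFree H, (hodgeQ H)⁻¹ e e ≤ C

/-- S3b statement: Coulomb decay of the Landau kernel, `|G_ee'| ≤ C(1+log H)/(1+d)²`. -/
def LandauKernelDecay : Prop :=
  ∃ C : ℝ, ∀ H : ℕ, 1 ≤ H → ∀ e e' : LandauFree H,
    |(hodgeQ H)⁻¹ e e'| ≤ C * (1 + Real.log H) / (1 + (⨆ k : Fin 4, |((e.1.1.1 k - e'.1.1.1 k : ℤ) : ℝ)|)) ^ 2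

/-! ## The reduction event (O1 + O3 + O4) and the comparison (O2 + O5), typed over the YM box state -/

/-- `SU(2)`. -/
abbrev SU2 : Type := Matrix.specialUnitaryGroup (Fin 2) ℂ

/-- Gauge transformations supported on the interior sites (identity on the boundary and outside: they fix the frozen walls). -/
def IsInteriorGauge (H : ℕ) (g : Literature.Probability.LatticeModels.Site 4 → SU2) : Prop :=
  ∀ x, x ∉ interiorSites H → g x = 1

/-- Link defect `2 − Re tr U_e = ½‖U_e − 1‖_F²` (no norm instance needed). -/
def linkDefect (U : Literature.MathematicalPhysics.QuantumLattice.LGConfig 4 SU2)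
    (e : Literature.MathematicalPhysics.QuantumLattice.ZdEdge 4) : ℝ := 2 - ((U e : Matrix (Fin 2) (Fin 2) ℂ).trace).re

/-- The configuration is interior-gauge-equivalent to one whose box links all lie in the ball of (defect-)radius `r`. -/
def InGaugeBall (H : ℕ) (r : ℝ) (U : Literature.MathematicalPhysics.QuantumLattice.LGConfig 4 SU2) : Prop :=
  ∃ g : Literature.Probability.LatticeModels.Site 4 → SU2, IsInteriorGauge H g ∧
    ∀ e ∈ boxEdges 4 (2 * H + 1), linkDefect (Literature.MathematicalPhysics.QuantumLattice.gaugeTransformZd g U) e ≤ r ^ 2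

/-- Cold-wall configurations: every link outside the cube `[0,2H]⁴` is the identity (the support of `boxState`). -/
def ColdWall (H : ℕ) (U : Literature.MathematicalPhysics.QuantumLattice.LGConfig 4 SU2) : Prop :=
  ∀ e, e ∉ boxEdges 4 (2 * H + 1) → U e = 1

/-- The small-field event: every plaquette based in `[−1, 2H]⁴` has cost `2 − Re tr U_p ≤ s²`. -/
def SmallPlaquettes (H : ℕ) (s : ℝ) (U : Literature.MathematicalPhysics.QuantumLattice.LGConfig 4 SU2) : Prop :=
  ∀ x : Literature.Probability.LatticeModels.Site 4, (∀ k, -1 ≤ x k ∧ x k ≤ 2 * (H : ℤ)) → ∀ i j : Fin 4, i ≠ j →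
    plaqCostAt (G := SU2) (Literature.MathematicalPhysics.QuantumLattice.fundamentalRep (Fin 2)) x i j U ≤ s ^ 2

/-- Lattice LANDAU GAUGE at the interior sites (the stationarity condition of `g ↦ Σ_e linkDefect (U^g)_e` over interior gauge transforms;
for `SU(2)` the anti-Hermitian part `U − Uᴴ` is automatically traceless): `Σ_μ (A_{x,μ} − A_{x−μ,μ}) = 0` with `A_e := U_e − U_eᴴ`. -/
def InLandauGauge (H : ℕ) (U : Literature.MathematicalPhysics.QuantumLattice.LGConfig 4 SU2) : Prop :=
  ∀ x ∈ interiorSites H,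
    (∑ μ : Fin 4, ((U (x, μ) : Matrix (Fin 2) (Fin 2) ℂ) - (U (x, μ) : Matrix (Fin 2) (Fin 2) ℂ)ᴴ)) =
      ∑ μ : Fin 4, ((U (x - Pi.single μ 1, μ) : Matrix (Fin 2) (Fin 2) ℂ) - (U (x - Pi.single μ 1, μ) : Matrix (Fin 2) (Fin 2) ℂ)ᴴ)

/-- S4b statement **(small Landau representative = discrete Uhlenbeck gauge fixing up to the cold wall; L)**: on the small-field event with
`s·H³(1+log H) ≤ c₀` (v5: the continuity/Newton method inverts the FP operator `Δ₀ + O(H·|A|)`, `λ_min(Δ₀) ≍ H⁻²`, along the path, which needs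
`H²·H s log H ≪ 1`; downstream `s = β^{−1/2+κ'}`, `H = β^θ`, so this is `θ < 1/6` — the family ceiling again), some interior gauge transform puts `U` in lattice Landau gauge with ALL box links within defect `C·H²(1+log H)²·s²` of the identity
(linearised: `A = G d*F`, `|∇G| ≲ (1+d)⁻³` ⇒ `|A| ≲ H log H · s`; nonlinear correction relative `O(H s log H)`).  Sources: Bałaban 1985 (gauge
fixing / Green's functions, `Balaban1985`, `Balaban1983RegularityDecay`), Uhlenbeck 1982 (continuum), Zwanziger 1982. -/
def LandauRepresentativeBound : Prop :=
  ∃ C c₀ : ℝ, 0 < C ∧ 0 < c₀ ∧ ∀ H : ℕ, 1 ≤ H → ∀ s : ℝ, 0 ≤ s → s * (H : ℝ) ^ 3 * (1 + Real.log H) ≤ c₀ →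
    ∀ U : Literature.MathematicalPhysics.QuantumLattice.LGConfig 4 SU2, ColdWall H U → SmallPlaquettes H s U →
      ∃ g : Literature.Probability.LatticeModels.Site 4 → SU2, IsInteriorGauge H g ∧
        InLandauGauge H (Literature.MathematicalPhysics.QuantumLattice.gaugeTransformZd g U) ∧
        ∀ e ∈ boxEdges 4 (2 * H + 1),
          linkDefect (Literature.MathematicalPhysics.QuantumLattice.gaugeTransformZd g U) e ≤ C * (H : ℝ) ^ 2 * (1 + Real.log H) ^ 2 * s ^ 2

/-- S4 statement **(gauge-ball reduction; at the filed θL = 1/13 an M-sized lemma)**: at scale `H = ⌈β^θ⌉`, `θ ≤ θL`, the cold-box state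
gives mass `≤ exp(−β^κ)` to configurations NOT interior-gauge-equivalent to one whose box links all have defect `≤ β^{−1+2κ}`.
RARITY BUDGET (v7 correction, 2026-08-29T09:45Z): in the COLD-WALL BOX state the landed large-field rarity is the Gibbs union bound
`Theorems.ColdBoxAllGroupsBoxFloorAllGroupsLargeFieldG.boxState_largeField_rarity_of_rep` — `boxState{∃ p, plaqCost_p ≥ β^{2ε−1}} ≤ exp(−β^ε)`
ONLY for ε > 2θ (the free-δ per-plaquette rarity `plaquetteLargeFieldRarity_eventually` is a TORUS chessboard estimate and does not transfer
to the flat datum).  Hence the small-plaquette scale is s = β^{−1/2+ε} with ε > 2θ, NOT a free κ'.  Two proof routes and their honest ranges: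
(a) FOREST (comb) gauge rooted at the cold wall + non-abelian Stokes (`linkDefect ≤ (2H²+2H)²·max_p plaqCost_p`): radius exponent κ > 2θ + ε >
4θ; with the S5 interlock κ < 1/2 − 3θL this closes iff θL < 1/14 — NOT enough for the filed 1/13;  (b) via S4b (the small LANDAU representative
on `SmallPlaquettes H s`: deviation ≤ C·H(1+log H)·s): κ > θ + ε > 3θ, closing iff θL < 1/12 ✓ (1/13 included; S4b's premise
s·H³(1+log H) ≤ c₀ ⇔ 3θ + ε < 1/2 ⇔ θ < 1/10 ✓).  So S4 is stated for θL < 1/12 and is M-sized GIVEN S4b (route (b)); route (a) alone is a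
1/14-lemma.  (Tail exponent κ₂ decoupled from κ as before.)  S4 is very plausibly TRUE for every θL (Landau-gauge links are O(β^{−1/2}√log)
w.h.p.), but beyond 1/12 its proof is the line's own content (S4⁺ = Landau-gauge concentration, `ConvexGribovBody.BrascampLiebVacuumSC`
⟨16404⟩) — not filed. -/
def GaugeBallReduction (θL κ : ℝ) : Prop :=
  ∃ κ₂ : ℝ, 0 < κ₂ ∧ ∀ θ : ℝ, 0 < θ → θ ≤ θL → ∃ β₀ : ℝ, ∀ β : ℝ, β₀ ≤ β →
    boxState (Literature.MathematicalPhysics.QuantumLattice.fundamentalRep (Fin 2)) β ⌈β ^ θ⌉₊ {U | ¬ InGaugeBall ⌈β ^ θ⌉₊ (β ^ (-(1 : ℝ) / 2 + κ)) U} ≤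
      ENNReal.ofReal (Real.exp (-(β ^ κ₂)))

/-- The Transfer target `C⁺(θL)`: RELATIVE Dirichlet comparison at all separations `T ≤ H` (the hypothesis of the proved currency lemma
`boxWindow_of_dirichletDominationRel_ceiling`, helper-2). -/
def LandauRelativeComparison (θL : ℝ) : Prop :=
  ∀ θ : ℝ, 0 < θ → θ ≤ θL → ∃ η : ℝ, 0 < η ∧ ∃ β₀ : ℝ, ∀ β : ℝ, β₀ ≤ β → ∀ T : ℕ, T ≤ ⌈β ^ θ⌉₊ →
    η * boxDirCircSqCov ⌈β ^ θ⌉₊ T ≤ β ^ 2 * boxPlaqCov (G := SU2) (Literature.MathematicalPhysics.QuantumLattice.fundamentalRep (Fin 2)) β ⌈β ^ θ⌉₊ T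

/-- The T-respecting currency (a TREE THEOREM since ✓p706506: `AllWindowsColdBox.boxWindow_of_dirichletDominationRel_ceiling`). -/
def RelativeCurrency : Prop :=
  ∀ θc : ℝ, LandauRelativeComparison θc →
    ∀ A θ : ℝ, 0 < A → A < θ → θ ≤ θc → ∃ c : ℝ, 0 < c ∧ BoxTwoPointDomination (G := SU2) (Literature.MathematicalPhysics.QuantumLattice.fundamentalRep (Fin 2)) A θ c

/-- The LOW CHILD of the proposed glued split of `BoxHighWindowsSU22`: windows with `1/16 < θ ≤ θL`. -/
def BoxWindowLowSU22 (θL : ℝ) : Prop :=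
  ∀ A θ : ℝ, 0 < A → A < θ → θ ≤ 7 * A → 1 / 16 < θ → θ ≤ θL →
    ∃ c : ℝ, 0 < c ∧ BoxTwoPointDomination (G := SU2) (Literature.MathematicalPhysics.QuantumLattice.fundamentalRep (Fin 2)) A θ c

/-- The HIGH CHILD (RG residual): windows with `θL < θ`. -/
def BoxWindowHighSU22 (θL : ℝ) : Prop :=
  ∀ A θ : ℝ, 0 < A → A < θ → θ ≤ 7 * A → θL < θ →
    ∃ c : ℝ, 0 < c ∧ BoxTwoPointDomination (G := SU2) (Literature.MathematicalPhysics.QuantumLattice.fundamentalRep (Fin 2)) A θ c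


/-- S4b statement of record (skeleton v11, 2026-08-29: = the v10 typing — premise `s·H⁴(1+log H)² ≤ c₀`, conclusion `(1+log H)⁴`, the one-step-bootstrap typing, STUB-PLAN-S4b §10 — under a NEW NAME, because the v9 body of `LandauRepresentativeBound` above is frozen by the gate's append-only rule; `LandauRepresentativeBound` (v9) is an unreferenced relic, logically STRONGER than this statement; registered stub: `stub_landauRepresentative : LandauBootstrapBound`) **(small Landau representative = discrete Uhlenbeck gauge fixing up to the cold wall; M since v10)**: on the small-field event with
`s·H⁴(1+log H)² ≤ c₀` (was `s·H³(1+log H)` (v5: the continuity/Newton method inverts the FP operator `Δ₀ + O(H·|A|)`, `λ_min(Δ₀) ≍ H⁻²`, along the path, which needs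
`H²·H s log H ≪ 1`; downstream `s = β^{−1/2+κ'}`, `H = β^θ`, so this is `θ < 1/6` — the family ceiling again), some interior gauge transform puts `U` in lattice Landau gauge with ALL box links within defect `C·H²(1+log H)²·s²` of the identity
(linearised: `A = G d*F`, `|∇G| ≲ (1+d)⁻³` ⇒ `|A| ≲ H log H · s`; nonlinear correction relative `O(H s log H)`).  Sources: Bałaban 1985 (gauge
fixing / Green's functions, `Balaban1985`, `Balaban1983RegularityDecay`), Uhlenbeck 1982 (continuum), Zwanziger 1982. -/
def LandauBootstrapBound : Prop :=
  ∃ C c₀ : ℝ, 0 < C ∧ 0 < c₀ ∧ ∀ H : ℕ, 1 ≤ H → ∀ s : ℝ, 0 ≤ s → s * (H : ℝ) ^ 4 * (1 + Real.log H) ^ 2 ≤ c₀ →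
    ∀ U : Literature.MathematicalPhysics.QuantumLattice.LGConfig 4 SU2, ColdWall H U → SmallPlaquettes H s U →
      ∃ g : Literature.Probability.LatticeModels.Site 4 → SU2, IsInteriorGauge H g ∧
        InLandauGauge H (Literature.MathematicalPhysics.QuantumLattice.gaugeTransformZd g U) ∧
        ∀ e ∈ boxEdges 4 (2 * H + 1),
          linkDefect (Literature.MathematicalPhysics.QuantumLattice.gaugeTransformZd g U) e ≤ C * (H : ℝ) ^ 2 * (1 + Real.log H) ^ 4 * s ^ 2

end Summit.QuantumFields.YangMills.Theorems.AllWindowsColdBoxBoxHighLine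

end
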